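import Mathlib.MeasureTheory.Group.FundamentalDomain
import Mathlib.MeasureTheory.Constructions.BorelSpace.Basic
import Mathlib.Topology.Algebra.Group.Basic
import Mathlib.Topology.Bases
import HarnessLib

/-!
# Strict measurable fundamental domains for discrete subgroups

Topic `MeasureTheory/Group`; namespace `Literature.MeasureTheory.Group`. Mathlib's unfolding
machinery (`MeasureTheory.IsFundamentalDomain`: `integral_eq_tsum`, the unfolding trick
`QuotientGroup.integral_eq_integral_automorphize`, `Measure.Haar.Quotient`) takes a fundamental
domain as *input* but constructs none beyond `ℤ`-lattices in euclidean spaces (`ZSpan.isAddFundamentalDomain`).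
For the unfoldings of automorphic forms along `N(K) ⊂ GL_n(𝔸_K)` and `GL_n(K) ⊂ GL_n(𝔸_K)`
(Getz–Hahn (2024), Lemma 9.2.4 and (9.16); Garrett (2018), §7.3, PDF p. 336) one needs the
classical existence statement, which this file PROVES:

* `existsUnique_smul_mem_strictFundamentalDomain` — abstract form: if a group `Γ` acts on `α`
  and `U : ℕ → Set α` is a cover by sets each meeting every orbit in at most one point
  (`x, γ • x ∈ U i ⇒ γ = 1`), then `strictFundamentalDomain Γ U = ⋃ᵢ (Uᵢ ∖ ⋃_{j<i} Γ • Uⱼ)`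
  contains **exactly one point of every orbit**; it is measurable when the `Uᵢ` are and `Γ` is
  countable acting measurably (`measurableSet_strictFundamentalDomain`).
* `Subgroup.exists_measurableSet_existsUnique_smul_mem` /
  `Subgroup.exists_measurableSet_existsUnique_op_smul_mem` — for a **discrete** subgroup `Γ` of a
  second countable topological group `G` (an identity neighbourhood `V` with `V ∩ Γ = {1}`), acting
  by left (resp. right) multiplication, there is a Borel set `𝓕 ⊆ G` with `∀ g, ∃! γ ∈ Γ, γ g ∈ 𝓕`
  (resp. `g γ ∈ 𝓕`): cover `G` by countably many translates `W gᵢ` (resp. `gᵢ W`) of an open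
  `W ∋ 1` with `W W⁻¹ ⊆ V` (resp. `W⁻¹ W ⊆ V`), which are such partial sections, and apply the
  abstract form (second countability makes the cover countable).
* `Subgroup.exists_isFundamentalDomain_of_discrete` / `…_op_of_discrete` — hence Mathlib
  fundamental domains (`IsFundamentalDomain.mk'`) for **every** measure, for `Γ` and for `Γ.op`
  (the form consumed by `QuotientGroup.integral_eq_integral_automorphize`).

All statements are additivised (`to_additive`). Classical (e.g. Bourbaki, *Intégration* VII §2
Ex. 12; Raghunathan, *Discrete subgroups of Lie groups* (1972), Ch. I, 1.8); tagged folklore.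
-/

open Set MeasureTheory Filter
open scoped Pointwise Topology

namespace Literature.MeasureTheory.Group

/-! ### The abstract construction -/

section Abstract

variable {Γ : Type*} [Group Γ] {α : Type*} [MulAction Γ α]

/-- The candidate fundamental domain attached to a sequence of partial sections `U i`:
`⋃ᵢ (Uᵢ ∖ ⋃_{j<i} ⋃_γ γ • Uⱼ)` (written with preimages `(γ⁻¹ • ·)⁻¹' Uⱼ = γ • Uⱼ`). [folklore] -/
@[to_additive strictAddFundamentalDomain /-- The candidate fundamental domain attached to a
sequence of partial sections `U i`: `⋃ᵢ (Uᵢ ∖ ⋃_{j<i} ⋃_γ γ +ᵥ Uⱼ)`. [folklore] -/]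
def strictFundamentalDomain (Γ : Type*) [Group Γ] [MulAction Γ α] (U : ℕ → Set α) : Set α :=
  ⋃ i, (U i \ ⋃ j < i, ⋃ γ : Γ, (fun x => γ⁻¹ • x) ⁻¹' U j)

/-- Membership in the candidate domain. [folklore] -/
@[to_additive mem_strictAddFundamentalDomain_iff /-- Membership in the candidate domain.
[folklore] -/]
theorem mem_strictFundamentalDomain_iff {U : ℕ → Set α} {x : α} :
    x ∈ strictFundamentalDomain Γ U ↔
      ∃ i, x ∈ U i ∧ ∀ j < i, ∀ γ : Γ, γ⁻¹ • x ∉ U j := by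
  simp only [strictFundamentalDomain, mem_iUnion, Set.mem_sdiff, mem_preimage, not_exists,
    exists_prop, not_and]

/-- **Exactly one point of every orbit.** If the `U i` cover `α` and each `U i` meets every orbit
in at most one point — `x ∈ U i`, `γ • x ∈ U i` force `γ = 1` — then every orbit meets
`strictFundamentalDomain Γ U` in exactly one point: `∀ x, ∃! γ, γ • x ∈ 𝓕`. [folklore] -/
@[to_additive existsUnique_vadd_mem_strictAddFundamentalDomain /-- **Exactly one point of every
orbit** (additive version). [folklore] -/]
theorem existsUnique_smul_mem_strictFundamentalDomain {U : ℕ → Set α}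
    (hcover : ∀ x, ∃ i, x ∈ U i)
    (hsec : ∀ i, ∀ x ∈ U i, ∀ γ : Γ, γ • x ∈ U i → γ = 1) (x : α) :
    ∃! γ : Γ, γ • x ∈ strictFundamentalDomain Γ U := by
  classical
  -- the least index of a `U i` meeting the orbit of `x`
  have hex : ∃ i, ∃ γ : Γ, γ • x ∈ U i := by
    obtain ⟨i, hi⟩ := hcover x
    exact ⟨i, 1, by rwa [one_smul]⟩
  set i := Nat.find hex with hi
  obtain ⟨γ₀, hγ₀⟩ : ∃ γ : Γ, γ • x ∈ U i := Nat.find_spec hex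
  have hmin : ∀ j < i, ∀ γ : Γ, γ • x ∉ U j := fun j hj γ hγ =>
    Nat.find_min hex hj ⟨γ, hγ⟩
  refine ⟨γ₀, ?_, fun γ hγ => ?_⟩
  · show γ₀ • x ∈ strictFundamentalDomain Γ U
    rw [mem_strictFundamentalDomain_iff]
    refine ⟨i, hγ₀, fun j hj γ hγ => hmin j hj (γ⁻¹ * γ₀) ?_⟩
    rwa [mul_smul]
  · change γ • x ∈ strictFundamentalDomain Γ U at hγ
    rw [mem_strictFundamentalDomain_iff] at hγ
    obtain ⟨i', hi', hmin'⟩ := hγ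
    -- `i' = i`
    have h1 : ¬ i' < i := fun hlt => hmin i' hlt γ hi'
    have h2 : ¬ i < i' := fun hlt => hmin' i hlt (γ * γ₀⁻¹) (by
      rwa [mul_inv_rev, inv_inv, mul_smul, inv_smul_smul])
    have heq : i' = i := le_antisymm (not_lt.1 h2) (not_lt.1 h1)
    rw [heq] at hi'
    -- both `γ • x` and `γ₀ • x` lie in `U i`
    have := hsec i (γ₀ • x) hγ₀ (γ * γ₀⁻¹) (by rwa [mul_smul, inv_smul_smul])
    exact mul_inv_eq_one.1 this

/-- The candidate domain is measurable when the `U i` are, for a countable group acting by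
measurable maps. [folklore] -/
@[to_additive measurableSet_strictAddFundamentalDomain /-- The candidate domain is measurable when
the `U i` are, for a countable group acting by measurable maps. [folklore] -/]
theorem measurableSet_strictFundamentalDomain [MeasurableSpace α] [Countable Γ]
    [MeasurableSpace Γ] [MeasurableSMul Γ α] {U : ℕ → Set α} (hU : ∀ i, MeasurableSet (U i)) :
    MeasurableSet (strictFundamentalDomain Γ U) := by
  refine MeasurableSet.iUnion fun i => (hU i).diff ?_
  refine MeasurableSet.biUnion (Set.to_countable _) fun j _ => ?_
  exact MeasurableSet.iUnion fun γ => measurable_const_smul _ (hU j)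

end Abstract

/-! ### Discrete subgroups of second countable groups -/

section Subgroup

variable {G : Type*} [Group G] [TopologicalSpace G] [IsTopologicalGroup G]
  (Γ : Subgroup G) [DiscreteTopology Γ]

/-- A discrete subgroup admits an open identity neighbourhood `W` with `w'w⁻¹ ∈ Γ ⇒ w' w⁻¹ = 1`
and `w⁻¹w' ∈ Γ ⇒ w⁻¹ w' = 1` for `w, w' ∈ W`. [folklore] -/
@[to_additive AddSubgroup.exists_isOpen_sub_mem_imp_eq_zero /-- A discrete additive subgroup
admits an open neighbourhood `W` of `0` with `w' - w ∈ Γ ⇒ w' - w = 0` and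
`-w + w' ∈ Γ ⇒ -w + w' = 0` for `w, w' ∈ W`. [folklore] -/]
theorem Subgroup.exists_isOpen_div_mem_imp_eq_one :
    ∃ W : Set G, IsOpen W ∧ (1 : G) ∈ W ∧
      (∀ w ∈ W, ∀ w' ∈ W, w' * w⁻¹ ∈ Γ → w' * w⁻¹ = 1) ∧
      (∀ w ∈ W, ∀ w' ∈ W, w⁻¹ * w' ∈ Γ → w⁻¹ * w' = 1) := by
  -- an identity neighbourhood meeting `Γ` only in `1`
  obtain ⟨V, hV, hV1⟩ : ∃ V : Set G, V ∈ 𝓝 (1 : G) ∧ ∀ γ ∈ Γ, γ ∈ V → γ = 1 := by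
    have h1 : IsOpen ({⟨1, Γ.one_mem⟩} : Set Γ) := isOpen_discrete _
    obtain ⟨V, hVo, hVeq⟩ := isOpen_induced_iff.1 h1
    refine ⟨V, hVo.mem_nhds ?_, fun γ hγ hγV => ?_⟩
    · have : (⟨1, Γ.one_mem⟩ : Γ) ∈ ((↑) : Γ → G) ⁻¹' V := by rw [hVeq]; exact mem_singleton _
      exact this
    · have : (⟨γ, hγ⟩ : Γ) ∈ ((↑) : Γ → G) ⁻¹' V := hγV
      rw [hVeq, mem_singleton_iff] at this
      exact congrArg Subtype.val this
  -- `W` open with `1 ∈ W`, `W * W⁻¹ ⊆ V` and `W⁻¹ * W ⊆ V`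
  obtain ⟨W₁, hW₁o, hW₁1, hW₁V⟩ : ∃ W₁ : Set G, IsOpen W₁ ∧ (1 : G) ∈ W₁ ∧
      ∀ w ∈ W₁, ∀ w' ∈ W₁, w' * w⁻¹ ∈ V := by
    have hc : Continuous fun p : G × G => p.2 * p.1⁻¹ := continuous_snd.mul continuous_fst.inv
    have hmem : (fun p : G × G => p.2 * p.1⁻¹) ⁻¹' V ∈ 𝓝 ((1 : G), (1 : G)) :=
      hc.continuousAt.preimage_mem_nhds (by simpa using hV)
    obtain ⟨A, hA, B, hB, hAB⟩ := mem_nhds_prod_iff.1 hmem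
    obtain ⟨W₁, hW₁sub, hW₁o, hW₁1⟩ := mem_nhds_iff.1 (inter_mem hA hB)
    exact ⟨W₁, hW₁o, hW₁1, fun w hw w' hw' =>
      hAB (mk_mem_prod (hW₁sub hw).1 (hW₁sub hw').2)⟩
  obtain ⟨W₂, hW₂o, hW₂1, hW₂V⟩ : ∃ W₂ : Set G, IsOpen W₂ ∧ (1 : G) ∈ W₂ ∧
      ∀ w ∈ W₂, ∀ w' ∈ W₂, w⁻¹ * w' ∈ V := by
    have hc : Continuous fun p : G × G => p.1⁻¹ * p.2 := continuous_fst.inv.mul continuous_snd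
    have hmem : (fun p : G × G => p.1⁻¹ * p.2) ⁻¹' V ∈ 𝓝 ((1 : G), (1 : G)) :=
      hc.continuousAt.preimage_mem_nhds (by simpa using hV)
    obtain ⟨A, hA, B, hB, hAB⟩ := mem_nhds_prod_iff.1 hmem
    obtain ⟨W₂, hW₂sub, hW₂o, hW₂1⟩ := mem_nhds_iff.1 (inter_mem hA hB)
    exact ⟨W₂, hW₂o, hW₂1, fun w hw w' hw' =>
      hAB (mk_mem_prod (hW₂sub hw).1 (hW₂sub hw').2)⟩
  refine ⟨W₁ ∩ W₂, hW₁o.inter hW₂o, ⟨hW₁1, hW₂1⟩, fun w hw w' hw' hmem => ?_,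
    fun w hw w' hw' hmem => ?_⟩
  · exact hV1 _ hmem (hW₁V w hw.1 w' hw'.1)
  · exact hV1 _ hmem (hW₂V w hw.2 w' hw'.2)

omit [DiscreteTopology Γ] in
variable {Γ} in
/-- A countable family of right (resp. left) translates of an open identity neighbourhood covers a
second countable group. [folklore] -/
@[to_additive exists_countable_cover_add_translates /-- A countable family of translates of an open
neighbourhood of `0` covers a second countable additive group. [folklore] -/]
theorem exists_countable_cover_translates [SecondCountableTopology G] {W : Set G} (hWo : IsOpen W)
    (hW1 : (1 : G) ∈ W) :
    (∃ g : ℕ → G, ∀ x : G, ∃ i, x ∈ (fun w => w * g i) '' W) ∧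
      (∃ g : ℕ → G, ∀ x : G, ∃ i, x ∈ (fun w => g i * w) '' W) := by
  constructor
  · -- right translates `W g`
    have hopen : ∀ g : G, IsOpen ((fun w => w * g) '' W) := fun g =>
      (Homeomorph.mulRight g).isOpenMap W hWo
    obtain ⟨T, hTc, hTU⟩ := TopologicalSpace.isOpen_iUnion_countable (fun g : G => (fun w => w * g) '' W) hopen
    have hcov : ∀ x : G, ∃ g ∈ T, x ∈ (fun w => w * g) '' W := by
      intro x
      have hx : x ∈ ⋃ g : G, (fun w => w * g) '' W := mem_iUnion.2 ⟨x, 1, hW1, one_mul x⟩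
      rw [← hTU] at hx
      simpa only [mem_iUnion, exists_prop] using hx
    have hTne : T.Nonempty := by obtain ⟨g, hg, -⟩ := hcov 1; exact ⟨g, hg⟩
    obtain ⟨g, hg⟩ := hTc.exists_eq_range hTne
    refine ⟨g, fun x => ?_⟩
    obtain ⟨t, ht, hxt⟩ := hcov x
    rw [hg] at ht
    obtain ⟨i, rfl⟩ := ht
    exact ⟨i, hxt⟩
  · -- left translates `g W`
    have hopen : ∀ g : G, IsOpen ((fun w => g * w) '' W) := fun g =>
      (Homeomorph.mulLeft g).isOpenMap W hWo
    obtain ⟨T, hTc, hTU⟩ := TopologicalSpace.isOpen_iUnion_countable (fun g : G => (fun w => g * w) '' W) hopen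
    have hcov : ∀ x : G, ∃ g ∈ T, x ∈ (fun w => g * w) '' W := by
      intro x
      have hx : x ∈ ⋃ g : G, (fun w => g * w) '' W := mem_iUnion.2 ⟨x, 1, hW1, mul_one x⟩
      rw [← hTU] at hx
      simpa only [mem_iUnion, exists_prop] using hx
    have hTne : T.Nonempty := by obtain ⟨g, hg, -⟩ := hcov 1; exact ⟨g, hg⟩
    obtain ⟨g, hg⟩ := hTc.exists_eq_range hTne
    refine ⟨g, fun x => ?_⟩
    obtain ⟨t, ht, hxt⟩ := hcov x
    rw [hg] at ht
    obtain ⟨i, rfl⟩ := ht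
    exact ⟨i, hxt⟩

variable [SecondCountableTopology G] [MeasurableSpace G] [BorelSpace G]

/-- **Strict Borel fundamental domain for the left multiplication action of a discrete subgroup**
of a second countable topological group: `∃ 𝓕` Borel with `∀ g, ∃! γ ∈ Γ, γ g ∈ 𝓕`. [folklore] -/
@[to_additive AddSubgroup.exists_measurableSet_existsUnique_vadd_mem /-- **Strict Borel fundamental
domain for the left translation action of a discrete additive subgroup** of a second countable
topological additive group. [folklore] -/]
theorem Subgroup.exists_measurableSet_existsUnique_smul_mem :
    ∃ 𝓕 : Set G, MeasurableSet 𝓕 ∧ ∀ g : G, ∃! γ : Γ, γ • g ∈ 𝓕 := by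
  haveI : Countable Γ := by
    haveI : SecondCountableTopology Γ := TopologicalSpace.Subtype.secondCountableTopology _
    exact countable_of_Lindelof_of_discrete
  obtain ⟨W, hWo, hW1, hWr, -⟩ := Subgroup.exists_isOpen_div_mem_imp_eq_one Γ
  obtain ⟨⟨g, hg⟩, -⟩ := exists_countable_cover_translates (G := G) hWo hW1
  set U : ℕ → Set G := fun i => (fun w => w * g i) '' W with hU
  refine ⟨strictFundamentalDomain Γ U, ?_, ?_⟩
  · refine measurableSet_strictFundamentalDomain fun i => ?_
    exact ((Homeomorph.mulRight (g i)).isOpenMap W hWo).measurableSet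
  · refine existsUnique_smul_mem_strictFundamentalDomain hg fun i x hx γ hγx => ?_
    obtain ⟨w, hw, rfl⟩ := hx
    obtain ⟨w', hw', he⟩ := hγx
    -- `γ w gᵢ = w' gᵢ`, so `γ = w' w⁻¹ ∈ W W⁻¹ ∩ Γ = {1}`
    have h0 : (γ : G) * (w * g i) = w' * g i := by
      simpa only [Subgroup.smul_def, smul_eq_mul] using he.symm
    have hγ : (γ : G) = w' * w⁻¹ := by
      have : (γ : G) * w = w' := by
        rw [← mul_assoc] at h0
        exact mul_right_cancel h0
      rw [← this, mul_inv_cancel_right]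
    have h1 : w' * w⁻¹ = 1 := hWr w hw w' hw' (hγ ▸ γ.2)
    exact Subtype.ext (hγ.trans h1)

/-- **Strict Borel fundamental domain for the right multiplication action of a discrete subgroup**
(Mathlib's `Γ.op` action, the convention of `G ⧸ Γ` and of the unfolding trick):
`∃ 𝓕` Borel with `∀ g, ∃! γ ∈ Γ, g γ ∈ 𝓕`. [folklore] -/
@[to_additive AddSubgroup.exists_measurableSet_existsUnique_op_vadd_mem /-- **Strict Borel
fundamental domain for the right translation action of a discrete additive subgroup** (Mathlib's
`Γ.op` action). [folklore] -/]
theorem Subgroup.exists_measurableSet_existsUnique_op_smul_mem :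
    ∃ 𝓕 : Set G, MeasurableSet 𝓕 ∧ ∀ g : G, ∃! γ : Γ.op, γ • g ∈ 𝓕 := by
  haveI : Countable Γ := by
    haveI : SecondCountableTopology Γ := TopologicalSpace.Subtype.secondCountableTopology _
    exact countable_of_Lindelof_of_discrete
  haveI : Countable Γ.op := Countable.of_equiv _ (Subgroup.equivOp Γ)
  obtain ⟨W, hWo, hW1, -, hWl⟩ := Subgroup.exists_isOpen_div_mem_imp_eq_one Γ
  obtain ⟨-, ⟨g, hg⟩⟩ := exists_countable_cover_translates (G := G) hWo hW1
  set U : ℕ → Set G := fun i => (fun w => g i * w) '' W with hU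
  refine ⟨strictFundamentalDomain Γ.op U, ?_, ?_⟩
  · refine measurableSet_strictFundamentalDomain fun i => ?_
    exact ((Homeomorph.mulLeft (g i)).isOpenMap W hWo).measurableSet
  · refine existsUnique_smul_mem_strictFundamentalDomain hg fun i x hx γ hγx => ?_
    obtain ⟨w, hw, rfl⟩ := hx
    obtain ⟨w', hw', he⟩ := hγx
    -- `gᵢ w γ = gᵢ w'`, so `γ = w⁻¹ w' ∈ W⁻¹ W ∩ Γ = {1}`
    have h0 : g i * w * MulOpposite.unop (γ : Gᵐᵒᵖ) = g i * w' := by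
      simpa only [Subgroup.smul_def, MulOpposite.smul_eq_mul_unop] using he.symm
    have hγ : MulOpposite.unop (γ : Gᵐᵒᵖ) = w⁻¹ * w' := by
      have h2 : w * MulOpposite.unop (γ : Gᵐᵒᵖ) = w' := by
        rw [mul_assoc] at h0
        exact mul_left_cancel h0
      rw [← h2, inv_mul_cancel_left]
    have h1 : w⁻¹ * w' = 1 := hWl w hw w' hw' (hγ ▸ Subgroup.mem_op.1 γ.2)
    refine Subtype.ext (MulOpposite.unop_injective ?_)
    rw [hγ, h1]
    rfl

/-- **Discrete subgroups of second countable groups have Borel fundamental domains** (left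
multiplication action), for every measure. [folklore] -/
@[to_additive AddSubgroup.exists_isAddFundamentalDomain_of_discrete /-- **Discrete additive
subgroups of second countable additive groups have Borel fundamental domains** (left translation
action), for every measure. [folklore] -/]
theorem Subgroup.exists_isFundamentalDomain_of_discrete (μ : Measure G) :
    ∃ 𝓕 : Set G, MeasurableSet 𝓕 ∧ IsFundamentalDomain Γ 𝓕 μ := by
  obtain ⟨𝓕, h𝓕m, h𝓕⟩ := Subgroup.exists_measurableSet_existsUnique_smul_mem Γ
  exact ⟨𝓕, h𝓕m, IsFundamentalDomain.mk' h𝓕m.nullMeasurableSet h𝓕⟩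

/-- **Discrete subgroups of second countable groups have Borel fundamental domains for the right
multiplication action `Γ.op`**, for every measure — the hypothesis of Mathlib's unfolding trick
`QuotientGroup.integral_eq_integral_automorphize` and of `MeasureTheory.Measure.Haar.Quotient`.
[folklore] -/
@[to_additive AddSubgroup.exists_isAddFundamentalDomain_op_of_discrete /-- **Discrete additive
subgroups of second countable additive groups have Borel fundamental domains for `Γ.op`**, for every
measure. [folklore] -/]
theorem Subgroup.exists_isFundamentalDomain_op_of_discrete (μ : Measure G) :
    ∃ 𝓕 : Set G, MeasurableSet 𝓕 ∧ IsFundamentalDomain Γ.op 𝓕 μ := by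
  obtain ⟨𝓕, h𝓕m, h𝓕⟩ := Subgroup.exists_measurableSet_existsUnique_op_smul_mem Γ
  exact ⟨𝓕, h𝓕m, IsFundamentalDomain.mk' h𝓕m.nullMeasurableSet h𝓕⟩

end Subgroup

end Literature.MeasureTheory.Group
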